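import Literature.Computability.Complexity.IrreducibilityLLLHensel
import Literature.Computability.Complexity.IrreducibilityLLLSmallPrime
import Mathlib.FieldTheory.Separable
import Mathlib.FieldTheory.Perfect
import HarnessLib

/-!
# The search for the small prime of LLL 1982, (3.6), on coefficient lists

Support file for the discharge of the named fact
`Literature.Computability.Complexity.lll_monicIrreducible_mem_P` (irreducibility of monic integer
polynomials is decidable in `P`; Lenstra–Lenstra–Lovász 1982, §3). The algorithm of LLL82 (3.6)
begins: "calculate the resultant `R(f, f')` … determine the smallest prime number `p` not dividing
`R(f, f')`", so that `f mod p` keeps its degree and is squarefree. Here the equivalent search is run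
directly: the least `p ≤ P` which is prime (trial division) and for which `gcd(f mod p, f' mod p) = 1`
(`pgcd`, `IrreducibilityLLLGcd.lean`), with the explicit range `P = 64 t²`, `t` the bit length of
`nⁿ |f|^{2n}` (`IrreducibilityLLLSmallPrime.lean`, `IrreducibilityLLLResultant.lean`):

* `pderiv` (the derivative on lists, `ofCoeffs_pderiv`), `isPrimeTD` (trial division,
  `isPrimeTD_iff`), `sqNormList`, `primeRange f = 64 t²`, `goodPrime f : Option ℕ`;
* `separable_of_not_dvd_resultant` — `p ∤ R(f, f')` makes `f mod p` separable (resultants commute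
  with reduction; padding the formal degree of `f'` costs a power of the leading coefficient `1`);
* `natAbs_resultant_le` — `|R(f, f')| ≤ nⁿ |f|^{2n}` (Hadamard, `abs_resultant_le`);
* **`goodPrime_some`**: a returned `p` is a prime `≤ primeRange f` with `f mod p` separable;
  **`goodPrime_ne_none_of_irreducible`**: if `f` (monic, `deg ≥ 1`) is irreducible then the search
  succeeds — irreducible ⇒ separable over `ℚ` ⇒ `R(f, f') ≠ 0` ⇒ some prime `≤ 64 t²` avoids it
  (`exists_prime_le_not_dvd_int`) ⇒ that prime passes the test.

## References

* A. K. Lenstra, H. W. Lenstra Jr., L. Lovász, Math. Ann. 261 (1982), §3, (3.6) and its proof.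
  [LenstraLenstraLovasz1982]
* M. R. Bremner, *Lattice Basis Reduction*, CRC Press 2011, §15.6, Lemmas 15.31–15.33 (squarefree
  modulo `p` iff `p ∤ disc`, the size of the prime). [Bremner2011]
-/

noncomputable section

namespace Literature.Computability.Complexity

open Polynomial SumcheckMA

namespace LLLFactoring

/-! ### Derivative, primality and the search range on lists -/

/-- The derivative on coefficient lists: `(a₀, a₁, a₂, …) ↦ (a₁, 2a₂, 3a₃, …)`. [folklore] -/
def pderiv (a : List ℤ) : List ℤ := (a.mapIdx fun i c => (i : ℤ) * c).tail

/-- `ofCoeffs (pderiv a) = (ofCoeffs a)'`. [folklore] -/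
theorem ofCoeffs_pderiv (a : List ℤ) : ofCoeffs (pderiv a) = derivative (ofCoeffs a) := by
  ext j
  rw [coeff_ofCoeffs, coeff_derivative, coeff_ofCoeffs, pderiv, List.getD_eq_getElem?_getD, List.getD_eq_getElem?_getD,
    List.getElem?_tail, List.getElem?_mapIdx]
  cases a[j + 1]? with
  | none => simp
  | some c => simp; ring

/-- Length of the derivative list. [folklore] -/
theorem length_pderiv (a : List ℤ) : (pderiv a).length = a.length - 1 := by
  simp [pderiv]

/-- Primality by trial division. [folklore] -/
def isPrimeTD (p : ℕ) : Bool := decide (2 ≤ p) && (List.range p).all fun d => decide (d < 2 ∨ p % d ≠ 0)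

/-- Trial division decides primality. [folklore] -/
theorem isPrimeTD_iff (p : ℕ) : isPrimeTD p = true ↔ p.Prime := by
  rw [isPrimeTD, Bool.and_eq_true, decide_eq_true_iff, List.all_eq_true, Nat.prime_def_lt]
  simp only [List.mem_range, decide_eq_true_iff]
  constructor
  · rintro ⟨h2, h⟩
    refine ⟨h2, fun m hm hdvd => ?_⟩
    rcases h m hm with hlt | hmod
    · interval_cases m
      · exact absurd (zero_dvd_iff.1 hdvd) (by omega)
      · rfl
    · exact absurd (Nat.mod_eq_zero_of_dvd hdvd) hmod
  · rintro ⟨h2, h⟩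
    refine ⟨h2, fun m hm => ?_⟩
    by_cases hm2 : m < 2
    · exact Or.inl hm2
    · refine Or.inr fun hmod => ?_
      have := h m hm (Nat.dvd_of_mod_eq_zero hmod)
      omega

/-- List sums over `range` are `Finset` sums. [folklore] -/
theorem list_sum_range_map (g : ℕ → ℤ) : ∀ n : ℕ, ((List.range n).map g).sum = ∑ i ∈ Finset.range n, g i
  | 0 => by simp
  | n + 1 => by rw [List.range_succ, List.map_append, List.sum_append, list_sum_range_map g n, Finset.sum_range_succ]; simp

/-- The squared Euclidean norm of a list, as a natural number. [folklore] -/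
def sqNormList (a : List ℤ) : ℕ := (a.map fun c => c.natAbs * c.natAbs).sum

/-- `sqNormList` as a sum over indices. [folklore] -/
theorem cast_sqNormList (a : List ℤ) : (sqNormList a : ℤ) = ∑ i ∈ Finset.range a.length, a.getD i 0 ^ 2 := by
  induction a with
  | nil => simp [sqNormList]
  | cons c a ih =>
    rw [sqNormList, List.map_cons, List.sum_cons, Nat.cast_add, Int.natAbs_mul_self, ← sqNormList, ih, List.length_cons,
      Finset.sum_range_succ']
    simp [sq, add_comm]

/-- `sqNormList a = |ofCoeffs a|²`. [folklore] -/
theorem sqNormList_eq (a : List ℤ) : (sqNormList a : ℤ) = sqNorm (ofCoeffs a) := by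
  have hN : (ofCoeffs a).natDegree < a.length + 1 := Nat.lt_succ_of_le ((natDegree_ofCoeffs_le a).trans (Nat.sub_le _ _))
  rw [cast_sqNormList, sqNorm_eq_sum_range hN, Finset.sum_range_succ, coeff_ofCoeffs, List.getD_eq_default _ _ le_rfl,
    zero_pow two_ne_zero, add_zero]
  exact Finset.sum_congr rfl fun i _ => by rw [coeff_ofCoeffs]

/-- The bound `nⁿ · (|f|²)ⁿ ≥ |R(f, f')|` (`n = |f| - 1`) whose bit length sizes the search. [cite: LenstraLenstraLovasz1982, proof of (3.6)] -/
def resBound (f : List ℤ) : ℕ := (f.length - 1) ^ (f.length - 1) * sqNormList f ^ (f.length - 1)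

/-- The search range `P = 64 t²`, `t` the bit length of `resBound f`. [cite: LenstraLenstraLovasz1982, proof of (3.6)] -/
def primeRange (f : List ℤ) : ℕ := 64 * (Nat.size (resBound f)) ^ 2

/-- The test at `p`: prime, and `gcd(f mod p, f' mod p) = 1`. [cite: LenstraLenstraLovasz1982, (3.6)] -/
def goodPrimeTest (f : List ℤ) (p : ℕ) : Bool := isPrimeTD p && decide (pgcd p (pnorm p f) (pnorm p (pderiv f)) = [1])

/-- **The prime of LLL82 (3.6)**: the least `p ≤ primeRange f` passing `goodPrimeTest`, if any.
[cite: LenstraLenstraLovasz1982, (3.6) ("the smallest prime p not dividing R(f, f')")] -/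
def goodPrime (f : List ℤ) : Option ℕ := (List.range (primeRange f + 1)).find? (goodPrimeTest f)

/-! ### Resultants modulo `p` and separability -/

/-- **`p ∤ R(f, f')` makes `f mod p` separable** (`f` monic): resultants commute with reduction
modulo `p`, and padding the formal degree of `f' mod p` up to `deg f'` only multiplies by a power of
the leading coefficient `1` of `f mod p`. [cite: Bremner2011, Lemmas 15.31–15.32] -/
theorem separable_map_of_not_dvd_resultant {p : ℕ} [hp : Fact p.Prime] {f : ℤ[X]} (hf : f.Monic)
    (hR : ¬(p : ℤ) ∣ resultant f (derivative f)) : (f.map (Int.castRingHom (ZMod p))).Separable := by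
  set φ := Int.castRingHom (ZMod p) with hφ
  have hfm : (f.map φ).Monic := hf.map φ
  have hdeg : (f.map φ).natDegree = f.natDegree := hf.natDegree_map φ
  set g := derivative (f.map φ) with hg
  have hgmap : g = (derivative f).map φ := by rw [hg, derivative_map]
  have hgle : g.natDegree ≤ (derivative f).natDegree := by rw [hgmap]; exact natDegree_map_le
  obtain ⟨k, hk⟩ := Nat.exists_eq_add_of_le hgle
  have hres : resultant (f.map φ) g f.natDegree (derivative f).natDegree = φ (resultant f (derivative f)) := by
    rw [hgmap, resultant_map_map]
  have hpad := resultant_add_right_deg (f.map φ) g f.natDegree g.natDegree k le_rfl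
  rw [← hk, hres, show (f.map φ).coeff f.natDegree = 1 by rw [← hdeg]; exact hfm.coeff_natDegree, one_pow, one_mul] at hpad
  have hne : resultant (f.map φ) g (f.map φ).natDegree g.natDegree ≠ 0 := by
    rw [hdeg, ← hpad]
    intro h0
    rw [hφ, Int.coe_castRingHom, ZMod.intCast_zmod_eq_zero_iff_dvd] at h0
    exact hR h0
  rw [separable_def, ← hg]
  exact (isUnit_resultant_iff_isCoprime hfm).1 (Ne.isUnit hne)

/-- **Irreducible monic integer polynomials have `R(f, f') ≠ 0`** (separability over `ℚ`).
[cite: LenstraLenstraLovasz1982, proof of (3.6)] -/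
theorem resultant_derivative_ne_zero_of_irreducible {f : ℤ[X]} (hf : f.Monic) (hirr : Irreducible f) :
    resultant f (derivative f) ≠ 0 := by
  set ψ := algebraMap ℤ ℚ with hψ
  have hψi : Function.Injective ψ := by rw [hψ]; exact Int.cast_injective
  have hirrq : Irreducible (f.map ψ) := (hf.irreducible_iff_irreducible_map_fraction_map).1 hirr
  have hsep : (f.map ψ).Separable := hirrq.separable
  rw [separable_def, derivative_map] at hsep
  have hne := resultant_ne_zero _ _ hsep
  rw [natDegree_map_eq_of_injective hψi, natDegree_map_eq_of_injective hψi, resultant_map_map] at hne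
  exact fun h => hne (by rw [h, map_zero])

/-! ### The size of `R(f, f')` -/

/-- `|f'|² ≤ n² |f|²` for `deg f = n`. [folklore] -/
theorem sqNorm_derivative_le (f : ℤ[X]) : sqNorm (derivative f) ≤ (f.natDegree : ℤ) ^ 2 * sqNorm f := by
  set n := f.natDegree with hn
  have hd : (derivative f).natDegree < n + 1 := Nat.lt_succ_of_le ((natDegree_derivative_le f).trans (Nat.sub_le _ _))
  rw [sqNorm_eq_sum_range hd, sqNorm_eq_sum_range (Nat.lt_succ_of_le (Nat.le_succ n)), Finset.mul_sum,
    Finset.sum_range_succ' (fun i => (n : ℤ) ^ 2 * f.coeff i ^ 2)]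
  have h0 : (0 : ℤ) ≤ (n : ℤ) ^ 2 * f.coeff 0 ^ 2 := by positivity
  refine le_trans (Finset.sum_le_sum fun j hj => ?_) (le_add_of_nonneg_right h0)
  rw [coeff_derivative, mul_pow]
  have hj' := Finset.mem_range.1 hj
  by_cases hc : f.coeff (j + 1) = 0
  · rw [hc]; simp
  · have hjn : j + 1 ≤ n := le_natDegree_of_ne_zero hc
    have h1 : ((j : ℤ) + 1) ^ 2 ≤ (n : ℤ) ^ 2 := by
      have : ((j + 1 : ℕ) : ℤ) ≤ n := by exact_mod_cast hjn
      push_cast at this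
      nlinarith
    nlinarith [sq_nonneg (f.coeff (j + 1))]

/-- **`|R(f, f')| ≤ nⁿ (|f|²)ⁿ`** for `f` monic of degree `n` (Hadamard: `|R| ≤ |f'|ⁿ |f|^{deg f'}`,
`|f'|² ≤ n² |f|²`, `|f|² ≥ 1`). [cite: Bremner2011, Lemma 15.30 (|disc f| ≤ (n+1)^{2n} |f|_∞^{2n-1})] -/
theorem natAbs_resultant_derivative_le {f : ℤ[X]} (hf : f.Monic) :
    (resultant f (derivative f)).natAbs ≤ f.natDegree ^ f.natDegree * (sqNorm f).natAbs ^ f.natDegree := by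
  set n := f.natDegree with hn
  set S := sqNorm f with hS
  have hS1 : 1 ≤ S := one_le_sqNorm_of_monic hf
  have hS0 : 0 ≤ S := by omega
  have h1 := abs_resultant_le f (derivative f) (le_refl n) (le_refl (derivative f).natDegree)
  -- square both sides
  have h2 : ((|resultant f (derivative f)| : ℤ) : ℝ) ^ 2 ≤ ((n : ℤ) ^ 2 * S : ℤ) ^ n * (S : ℝ) ^ n := by
    have := pow_le_pow_left₀ (by positivity) h1 2
    rw [mul_pow, ← pow_mul, ← pow_mul, mul_comm n 2, mul_comm (derivative f).natDegree 2, pow_mul, pow_mul,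
      rnorm_sq, rnorm_sq] at this
    refine this.trans ?_
    have hA : (sqNorm (derivative f) : ℝ) ^ n ≤ (((n : ℤ) ^ 2 * S : ℤ) : ℝ) ^ n := by
      refine pow_le_pow_left₀ (by exact_mod_cast sqNorm_nonneg _) ?_ n
      exact_mod_cast sqNorm_derivative_le f
    have hB : (S : ℝ) ^ (derivative f).natDegree ≤ (S : ℝ) ^ n :=
      pow_le_pow_right₀ (by exact_mod_cast hS1) ((natDegree_derivative_le f).trans (Nat.sub_le _ _))
    exact mul_le_mul hA hB (by positivity) (by positivity)
  have h3 : (|resultant f (derivative f)| : ℤ) ^ 2 ≤ ((n : ℤ) ^ n * S ^ n) ^ 2 := by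
    have : ((|resultant f (derivative f)| : ℤ) : ℝ) ^ 2 ≤ ((((n : ℤ) ^ n * S ^ n) ^ 2 : ℤ) : ℝ) := by
      refine h2.trans (le_of_eq ?_); push_cast; ring
    exact_mod_cast this
  have h4 : |resultant f (derivative f)| ≤ (n : ℤ) ^ n * S ^ n :=
    abs_le_of_sq_le_sq' h3 (by positivity) |>.2
  have h5 : ((resultant f (derivative f)).natAbs : ℤ) ≤ ((n ^ n * S.natAbs ^ n : ℕ) : ℤ) := by
    rw [Int.natCast_natAbs, Nat.cast_mul, Nat.cast_pow, Nat.cast_pow, Int.natCast_natAbs, abs_of_nonneg hS0]; exact h4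
  exact_mod_cast h5

/-! ### Specification of the search -/

section Spec

variable {f : List ℤ} {n : ℕ}

/-- The reductions of `f` and `f'` read by the gcd test. [folklore] -/
theorem toZMod_pnorm_pderiv (p : ℕ) (f : List ℤ) :
    toZMod p (pnorm p f) = (ofCoeffs f).map (Int.castRingHom (ZMod p)) ∧
      toZMod p (pnorm p (pderiv f)) = derivative ((ofCoeffs f).map (Int.castRingHom (ZMod p))) := by
  refine ⟨toZMod_pnorm _, ?_⟩
  rw [toZMod_pnorm, toZMod, ofCoeffs_pderiv, derivative_map]

/-- **A returned prime is good**: `goodPrime f = some p` gives a prime `p ≤ primeRange f` modulo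
which `f` is separable. [cite: LenstraLenstraLovasz1982, (3.6)] -/
theorem goodPrime_some {p : ℕ} (h : goodPrime f = some p) :
    p.Prime ∧ p ≤ primeRange f ∧ ((ofCoeffs f).map (Int.castRingHom (ZMod p))).Separable := by
  have hpred := List.find?_some h
  have hmem := List.mem_of_find?_eq_some h
  rw [goodPrimeTest, Bool.and_eq_true, isPrimeTD_iff, decide_eq_true_iff] at hpred
  obtain ⟨hprime, hgcd⟩ := hpred
  haveI : Fact p.Prime := ⟨hprime⟩
  refine ⟨hprime, by have := List.mem_range.1 hmem; omega, ?_⟩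
  have hcop := (isCoprime_iff_pgcd_eq_one (p := p) (pnorm p f) (pnorm p (pderiv f))).2 hgcd
  rw [(toZMod_pnorm_pderiv p f).1, (toZMod_pnorm_pderiv p f).2] at hcop
  exact (separable_def _).2 hcop

/-- **The search succeeds on irreducible input**: for `f` the list of a monic integer polynomial of
degree `n ≥ 1` which is irreducible, `goodPrime f ≠ none`. (Irreducible ⇒ `R(f, f') ≠ 0` ⇒ some
prime `p ≤ 64 t²` does not divide it ⇒ that prime passes the test.) [cite: LenstraLenstraLovasz1982, proof of (3.6)] -/
theorem goodPrime_ne_none_of_irreducible (hf : MonicList f n) (hirr : Irreducible (ofCoeffs f)) : goodPrime f ≠ none := by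
  obtain ⟨hmon, hdeg⟩ := hf.monic_ofCoeffs
  have hR := resultant_derivative_ne_zero_of_irreducible hmon hirr
  obtain ⟨p, hprime, hple, hndvd⟩ := exists_prime_le_not_dvd_int hR
  haveI : Fact p.Prime := ⟨hprime⟩
  -- the prime is in range
  have hB0 : resBound f ≠ 0 := by
    have hS : 1 ≤ sqNormList f := by
      have := one_le_sqNorm_of_monic hmon; rw [← sqNormList_eq] at this; exact_mod_cast this
    have h1 : 0 < (f.length - 1) ^ (f.length - 1) := by
      rcases Nat.eq_zero_or_pos (f.length - 1) with h | h
      · rw [h]; exact Nat.one_pos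
      · exact Nat.pow_pos h
    exact Nat.pos_iff_ne_zero.1 (Nat.mul_pos h1 (Nat.pow_pos hS))
  have hrange : p ≤ primeRange f := by
    refine hple.trans ?_
    have hRle : (resultant (ofCoeffs f) (derivative (ofCoeffs f))).natAbs ≤ resBound f := by
      have h := natAbs_resultant_derivative_le hmon
      rw [← sqNormList_eq, Int.natAbs_natCast] at h
      rw [resBound, hf.1, Nat.add_sub_cancel, ← hdeg]
      exact h
    -- `Nat.size B = ⌊log₂ B⌋ + 1` (as in `LPO.size_eq_log_succ`)
    have hsz : Nat.size (resBound f) = Nat.log 2 (resBound f) + 1 :=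
      le_antisymm (Nat.size_le.2 (Nat.lt_pow_succ_log_self one_lt_two _)) (Nat.lt_size.2 (Nat.pow_log_le_self 2 hB0))
    have h1 : Nat.log 2 (resultant (ofCoeffs f) (derivative (ofCoeffs f))).natAbs + 1 ≤ Nat.size (resBound f) := by
      rw [hsz]; exact Nat.succ_le_succ (Nat.log_mono_right hRle)
    refine (smallPrimeBound_mono h1).trans ?_
    rw [primeRange]
    exact smallPrimeBound_le (by rw [hsz]; omega)
  -- and passes the test
  have hsep := separable_map_of_not_dvd_resultant hmon hndvd
  have htest : goodPrimeTest f p = true := by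
    rw [goodPrimeTest, Bool.and_eq_true, isPrimeTD_iff, decide_eq_true_iff]
    refine ⟨hprime, (isCoprime_iff_pgcd_eq_one (p := p) _ _).1 ?_⟩
    rw [(toZMod_pnorm_pderiv p f).1, (toZMod_pnorm_pderiv p f).2]
    exact (separable_def _).1 hsep
  intro hnone
  rw [goodPrime, List.find?_eq_none] at hnone
  exact absurd htest (by simpa using hnone p (List.mem_range.2 (by omega)))

end Spec

end LLLFactoring

end Literature.Computability.Complexity
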